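import Mathlib
import Summits.Ventures.PercRepro2.Defs
import Summits.Ventures.PercRepro2.Independence
import Summits.Ventures.PercRepro2.Harris
import Summits.Ventures.PercRepro2.Graph
import Summits.Ventures.PercRepro2.Events
import Summits.Ventures.PercRepro2.PsiUniSure
import Summits.Ventures.PercRepro2.PsiUniExplored
import Summits.Ventures.PercRepro2.PsiTEdge
import Summits.Ventures.PercRepro2.R21OEdgeSGraph

/-!
# The last edge of the `o`-exploration: `T_f` is the RE-MARKED slack (PercRepro2, p2)

Let `f = {x, z}` be the ONLY unpinned edge at the explored `o`-component `Λ` (`x ∈ Λ`, `z ∉ Λ`; `z`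
marked or not).  In the closed world `p[f↦0]` the component `Λ` is a full cluster with a closed
boundary, in the open world `p[f↦1]` it is a pendant blob hanging from `z`.  Writing all events in
the closed world and `Λ_v := v ∈ Λ` (a constant), the open-world events are
`a¹ = a ∨ (Λ_s ∧ {z ↔ u}) ∨ ({s ↔ z} ∧ Λ_u)`, `h¹ = Λ_s ∨ {s ↔ z}`, `ℓ¹ = Λ_y ∨ {y ↔ z}`,
`𝟙¹ = 𝟙 ∧ ¬(Λ_s ∧ {z ↔ y}) ∧ ¬({s ↔ z} ∧ Λ_y)`, and the closed-world `h = Λ_s`, `ℓ = Λ_y`.  Hence the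
symmetric mixed Bernstein coefficient `T_f` of the (R2-1) slack (P2-G21-SINGLEEDGE.md §3) is

* `0` when `s ∈ Λ`; `0` when `y ∈ Λ`, `s ∉ Λ`;
* `P⁰(𝟙)·P⁰(s ↔ z) + P⁰(𝟙 ∧ s ↔ z) ≥ 0` when `u ∈ Λ`, `s, y ∉ Λ`;
* **`R(p[f↦0]; s, y, z, u)`**, the closed-world (R2-1) slack with `o` RE-MARKED as `z`, when `Λ`
  carries no mark — the pendant blob transfers the role of `o` to `z`.

So the last unpinned edge at `Λ` always has `T_f ≥ 0` under the induction hypothesis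
«(R2-1) for every mark assignment» (`r21_T_nonneg_of_single_edge`): in the pin induction of
`R21TFrame.lean` run on the predicate «∀ marks, 0 ≤ R», the edge closing the `o`-exploration is never
the obstruction.  Exact check of the four identities: 120 / 120 random instances (single_edge_test.py).

* `conn_closed_o_iff_single` — in the closed world `o ↔ v` iff `v ∈ Λ`;
* `r21_single_edge_open_masses` / `r21_single_edge_closed_masses` — the eighteen masses in closed-world terms;
* `r21_T_nonneg_of_single_edge` — **the theorem**.
-/

namespace Summit.Ventures.PercRepro2

section SingleEdge

variable {V : Type*} {E : Type*} [Fintype E] [DecidableEq E]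
  {R : Type*} [CommRing R] [LinearOrder R] [IsStrictOrderedRing R]

omit [Fintype E] [IsStrictOrderedRing R] in
/-- The pinned-open configuration lies below every configuration respecting the open pins off `f`
with `f` closed (`p f ≠ 1`). -/
lemma pinned_le_update_false_of_respects_off {p : E → R} {ω : Config E} {f : E} (hpf : p f ≠ 1)
    (h1 : ∀ e, e ≠ f → p e = 1 → ω e = true) :
    (fun e => decide (p e = 1)) ≤ Function.update ω f false := by
  intro e
  by_cases hef : e = f
  · subst hef; simp [hpf]
  · rw [Function.update_of_ne hef]
    by_cases h : p e = 1
    · simp [h, h1 e hef h]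
    · simp [h]

omit [Fintype E] [IsStrictOrderedRing R] in
/-- **The closed world of the last edge.** With every edge at the explored `o`-component pinned except
`f` (`p f ≠ 1`), on a configuration respecting the pins off `f`, `o ↔ v` with `f` closed holds exactly
when `v` lies in the explored component. -/
lemma conn_closed_o_iff_single {ends : E → Sym2 V} {p : E → R} {ω : Config E} {f : E} {o : V}
    (hpf : p f ≠ 1)
    (hpin : ∀ e, e ≠ f → (∃ v ∈ ends e, Conn ends (fun e => decide (p e = 1)) o v) →
      p e = 0 ∨ p e = 1)
    (h0 : ∀ e, e ≠ f → p e = 0 → ω e = false) (h1 : ∀ e, e ≠ f → p e = 1 → ω e = true) (v : V) :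
    Conn ends (Function.update ω f false) o v ↔ Conn ends (fun e => decide (p e = 1)) o v := by
  constructor
  · intro h
    refine conn_pinned_of_conn_off (p := p) hpin (fun e he hpe => ?_) (by simp) h
    rw [Function.update_of_ne he]; exact h0 e he hpe
  · intro h
    exact conn_mono (pinned_le_update_false_of_respects_off hpf h1) h

omit [IsStrictOrderedRing R] in
/-- Same-world congruence: two events agreeing on the configurations respecting the pins off `f`
(with `f` closed) have the same probability under `p[f↦0]`. -/
lemma prob_update_zero_congr_of_respects (p : E → R) (f : E) {A A' : Set (Config E)}
    (h : ∀ ω : Config E, (∀ e, e ≠ f → p e = 0 → ω e = false) →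
      (∀ e, e ≠ f → p e = 1 → ω e = true) →
      (Function.update ω f false ∈ A ↔ Function.update ω f false ∈ A')) :
    prob (Function.update p f 0) A = prob (Function.update p f 0) A' := by
  rw [prob_eq_expect_indicator, prob_eq_expect_indicator, expect_update_zero, expect_update_zero]
  unfold expect
  refine Finset.sum_congr rfl fun ω _ => ?_
  by_cases hr : (∀ e, e ≠ f → p e = 0 → ω e = false) ∧ (∀ e, e ≠ f → p e = 1 → ω e = true)
  · congr 1
    by_cases hω : Function.update ω f false ∈ A
    · have h' := (h ω hr.1 hr.2).1 hω
      simp [hω, h']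
    · have h' : Function.update ω f false ∉ A' := fun h' => hω ((h ω hr.1 hr.2).2 h')
      simp [hω, h']
  · have hw : weight p ω = 0 := by
      rw [not_and_or] at hr
      rcases hr with hr | hr
      · obtain ⟨e, he⟩ := not_forall.1 hr
        obtain ⟨_, he⟩ := Classical.not_imp.1 he
        obtain ⟨hpe, hωe⟩ := Classical.not_imp.1 he
        exact weight_eq_zero_of_breaks_pin p ω (Or.inl ⟨hpe, by simpa using hωe⟩)
      · obtain ⟨e, he⟩ := not_forall.1 hr
        obtain ⟨_, he⟩ := Classical.not_imp.1 he
        obtain ⟨hpe, hωe⟩ := Classical.not_imp.1 he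
        exact weight_eq_zero_of_breaks_pin p ω (Or.inr ⟨hpe, by simpa using hωe⟩)
    rw [hw, zero_mul, zero_mul]


omit [Fintype E] [IsStrictOrderedRing R] in
/-- The closed-world atoms on a configuration respecting the pins off `f`: the connections to the
explored component are the constants `Λ_v`, and the marks inside `Λ` are joined to nothing outside. -/
lemma r21_single_edge_atoms {ends : E → Sym2 V} {p : E → R} {ω : Config E} {f : E} {o x z : V}
    (s y u : V) (_hf : ends f = s(x, z)) (hx : Conn ends (fun e => decide (p e = 1)) o x)
    (hz : ¬ Conn ends (fun e => decide (p e = 1)) o z) (hpf : p f ≠ 1)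
    (hpin : ∀ e, e ≠ f → (∃ v ∈ ends e, Conn ends (fun e => decide (p e = 1)) o v) →
      p e = 0 ∨ p e = 1)
    (h0 : ∀ e, e ≠ f → p e = 0 → ω e = false) (h1 : ∀ e, e ≠ f → p e = 1 → ω e = true) :
    (Conn ends (Function.update ω f false) s x ↔ Conn ends (fun e => decide (p e = 1)) o s) ∧
    (Conn ends (Function.update ω f false) s o ↔ Conn ends (fun e => decide (p e = 1)) o s) ∧
    (Conn ends (Function.update ω f false) x u ↔ Conn ends (fun e => decide (p e = 1)) o u) ∧
    (Conn ends (Function.update ω f false) z o ↔ False) ∧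
    (Conn ends (Function.update ω f false) x o ↔ True) ∧
    (Conn ends (Function.update ω f false) y x ↔ Conn ends (fun e => decide (p e = 1)) o y) ∧
    (Conn ends (Function.update ω f false) y o ↔ Conn ends (fun e => decide (p e = 1)) o y) ∧
    (Conn ends (Function.update ω f false) x y ↔ Conn ends (fun e => decide (p e = 1)) o y) ∧
    (Conn ends (Function.update ω f false) z y ↔ Conn ends (Function.update ω f false) y z) ∧
    (Conn ends (fun e => decide (p e = 1)) o s → (Conn ends (Function.update ω f false) s u ↔ Conn ends (fun e => decide (p e = 1)) o u)) ∧
    (Conn ends (fun e => decide (p e = 1)) o s → (Conn ends (Function.update ω f false) s y ↔ Conn ends (fun e => decide (p e = 1)) o y)) ∧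
    (Conn ends (fun e => decide (p e = 1)) o s → ¬ Conn ends (Function.update ω f false) s z) ∧
    (¬ Conn ends (fun e => decide (p e = 1)) o s → Conn ends (fun e => decide (p e = 1)) o u → ¬ Conn ends (Function.update ω f false) s u) ∧
    (¬ Conn ends (fun e => decide (p e = 1)) o s → Conn ends (fun e => decide (p e = 1)) o y → ¬ Conn ends (Function.update ω f false) s y) ∧
    (Conn ends (fun e => decide (p e = 1)) o u → ¬ Conn ends (Function.update ω f false) z u) ∧
    (Conn ends (fun e => decide (p e = 1)) o y → ¬ Conn ends (Function.update ω f false) y z) := by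
  have hΛ := conn_closed_o_iff_single (ends := ends) hpf hpin h0 h1
  have hox : Conn ends (Function.update ω f false) o x := (hΛ x).2 hx
  refine ⟨?_, ?_, ?_, ?_, ?_, ?_, ?_, ?_, ?_, ?_, ?_, ?_, ?_, ?_, ?_, ?_⟩
  · rw [← hΛ s]; exact ⟨fun h => conn_trans hox (conn_symm h), fun h => conn_trans (conn_symm h) hox⟩
  · rw [← hΛ s]; exact ⟨fun h => conn_symm h, fun h => conn_symm h⟩
  · rw [← hΛ u]; exact ⟨fun h => conn_trans hox h, fun h => conn_trans (conn_symm hox) h⟩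
  · exact ⟨fun h => hz ((hΛ z).1 (conn_symm h)), fun h => h.elim⟩
  · exact ⟨fun _ => trivial, fun _ => conn_symm hox⟩
  · rw [← hΛ y]; exact ⟨fun h => conn_trans hox (conn_symm h), fun h => conn_trans (conn_symm h) hox⟩
  · rw [← hΛ y]; exact ⟨fun h => conn_symm h, fun h => conn_symm h⟩
  · rw [← hΛ y]; exact ⟨fun h => conn_trans hox h, fun h => conn_trans (conn_symm hox) h⟩
  · exact ⟨fun h => conn_symm h, fun h => conn_symm h⟩
  · intro hs; rw [← hΛ u]; have hos := (hΛ s).2 hs; exact ⟨fun h => conn_trans hos h, fun h => conn_trans (conn_symm hos) h⟩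
  · intro hs; rw [← hΛ y]; have hos := (hΛ s).2 hs; exact ⟨fun h => conn_trans hos h, fun h => conn_trans (conn_symm hos) h⟩
  · intro hs h; exact hz ((hΛ z).1 (conn_trans ((hΛ s).2 hs) h))
  · intro hs hu h; exact hs ((hΛ s).1 (conn_trans ((hΛ u).2 hu) (conn_symm h)))
  · intro hs hy h; exact hs ((hΛ s).1 (conn_trans ((hΛ y).2 hy) (conn_symm h)))
  · intro hu h; exact hz ((hΛ z).1 (conn_trans ((hΛ u).2 hu) (conn_symm h)))
  · intro hy h; exact hz ((hΛ z).1 (conn_trans ((hΛ y).2 hy) h))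

set_option linter.unusedSimpArgs false in
omit [IsStrictOrderedRing R] in
/-- **The open world of the last edge, in closed-world terms** (the constants `Λ_v` baked in). -/
lemma r21_single_edge_open_masses (p : E → R) (ends : E → Sym2 V) (s y o u x z : V) (f : E)
    (hf : ends f = s(x, z)) (hx : Conn ends (fun e => decide (p e = 1)) o x)
    (hz : ¬ Conn ends (fun e => decide (p e = 1)) o z) (hpf : p f ≠ 1)
    (hpin : ∀ e, e ≠ f → (∃ v ∈ ends e, Conn ends (fun e => decide (p e = 1)) o v) →
      p e = 0 ∨ p e = 1) :
      prob (Function.update p f 1) (connEvent ends s u ∩ clusterInEvent ends s {W : Set V | o ∈ W} ∩ (connEvent ends s y)ᶜ) =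
        prob (Function.update p f 0) {ω : Config E | (((Conn ends (fun e => decide (p e = 1)) o s ∧ Conn ends (fun e => decide (p e = 1)) o u) ∨ (¬Conn ends (fun e => decide (p e = 1)) o s ∧ ¬Conn ends (fun e => decide (p e = 1)) o u ∧ Conn ends ω s u)) ∨ (Conn ends (fun e => decide (p e = 1)) o s ∧ (¬Conn ends (fun e => decide (p e = 1)) o u ∧ Conn ends ω z u)) ∨ ((¬Conn ends (fun e => decide (p e = 1)) o s ∧ Conn ends ω s z) ∧ Conn ends (fun e => decide (p e = 1)) o u)) ∧ (Conn ends (fun e => decide (p e = 1)) o s ∨ (¬Conn ends (fun e => decide (p e = 1)) o s ∧ Conn ends ω s z)) ∧ ¬(((Conn ends (fun e => decide (p e = 1)) o s ∧ Conn ends (fun e => decide (p e = 1)) o y) ∨ (¬Conn ends (fun e => decide (p e = 1)) o s ∧ ¬Conn ends (fun e => decide (p e = 1)) o y ∧ Conn ends ω s y)) ∨ (Conn ends (fun e => decide (p e = 1)) o s ∧ (¬Conn ends (fun e => decide (p e = 1)) o y ∧ Conn ends ω y z)) ∨ ((¬Conn ends (fun e => decide (p e = 1)) o s ∧ Conn ends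 ω s z) ∧ Conn ends (fun e => decide (p e = 1)) o y))} ∧
      prob (Function.update p f 1) (connEvent ends s u ∩ connEvent ends y o ∩ (connEvent ends s y)ᶜ) =
        prob (Function.update p f 0) {ω : Config E | (((Conn ends (fun e => decide (p e = 1)) o s ∧ Conn ends (fun e => decide (p e = 1)) o u) ∨ (¬Conn ends (fun e => decide (p e = 1)) o s ∧ ¬Conn ends (fun e => decide (p e = 1)) o u ∧ Conn ends ω s u)) ∨ (Conn ends (fun e => decide (p e = 1)) o s ∧ (¬Conn ends (fun e => decide (p e = 1)) o u ∧ Conn ends ω z u)) ∨ ((¬Conn ends (fun e => decide (p e = 1)) o s ∧ Conn ends ω s z) ∧ Conn ends (fun e => decide (p e = 1)) o u)) ∧ (Conn ends (fun e => decide (p e = 1)) o y ∨ (¬Conn ends (fun e => decide (p e = 1)) o y ∧ Conn ends ω y z)) ∧ ¬(((Conn ends (fun e => decide (p e = 1)) o s ∧ Conn ends (fun e => decide (p e = 1)) o y) ∨ (¬Conn ends (fun e => decide (p e = 1)) o s ∧ ¬Conn ends (fun e => decide (p e = 1)) o y ∧ Conn ends ω s y)) ∨ (Conn ends (fun e =>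 decide (p e = 1)) o s ∧ (¬Conn ends (fun e => decide (p e = 1)) o y ∧ Conn ends ω y z)) ∨ ((¬Conn ends (fun e => decide (p e = 1)) o s ∧ Conn ends ω s z) ∧ Conn ends (fun e => decide (p e = 1)) o y))} ∧
      prob (Function.update p f 1) ((connEvent ends s y)ᶜ) =
        prob (Function.update p f 0) {ω : Config E | ¬(((Conn ends (fun e => decide (p e = 1)) o s ∧ Conn ends (fun e => decide (p e = 1)) o y) ∨ (¬Conn ends (fun e => decide (p e = 1)) o s ∧ ¬Conn ends (fun e => decide (p e = 1)) o y ∧ Conn ends ω s y)) ∨ (Conn ends (fun e => decide (p e = 1)) o s ∧ (¬Conn ends (fun e => decide (p e = 1)) o y ∧ Conn ends ω y z)) ∨ ((¬Conn ends (fun e => decide (p e = 1)) o s ∧ Conn ends ω s z) ∧ Conn ends (fun e => decide (p e = 1)) o y))} ∧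
      prob (Function.update p f 1) (connEvent ends s u ∩ clusterInEvent ends s {W : Set V | o ∈ W}) =
        prob (Function.update p f 0) {ω : Config E | (((Conn ends (fun e => decide (p e = 1)) o s ∧ Conn ends (fun e => decide (p e = 1)) o u) ∨ (¬Conn ends (fun e => decide (p e = 1)) o s ∧ ¬Conn ends (fun e => decide (p e = 1)) o u ∧ Conn ends ω s u)) ∨ (Conn ends (fun e => decide (p e = 1)) o s ∧ (¬Conn ends (fun e => decide (p e = 1)) o u ∧ Conn ends ω z u)) ∨ ((¬Conn ends (fun e => decide (p e = 1)) o s ∧ Conn ends ω s z) ∧ Conn ends (fun e => decide (p e = 1)) o u)) ∧ (Conn ends (fun e => decide (p e = 1)) o s ∨ (¬Conn ends (fun e => decide (p e = 1)) o s ∧ Conn ends ω s z))} ∧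
      prob (Function.update p f 1) (connEvent ends s u ∩ (connEvent ends s y)ᶜ) =
        prob (Function.update p f 0) {ω : Config E | (((Conn ends (fun e => decide (p e = 1)) o s ∧ Conn ends (fun e => decide (p e = 1)) o u) ∨ (¬Conn ends (fun e => decide (p e = 1)) o s ∧ ¬Conn ends (fun e => decide (p e = 1)) o u ∧ Conn ends ω s u)) ∨ (Conn ends (fun e => decide (p e = 1)) o s ∧ (¬Conn ends (fun e => decide (p e = 1)) o u ∧ Conn ends ω z u)) ∨ ((¬Conn ends (fun e => decide (p e = 1)) o s ∧ Conn ends ω s z) ∧ Conn ends (fun e => decide (p e = 1)) o u)) ∧ ¬(((Conn ends (fun e => decide (p e = 1)) o s ∧ Conn ends (fun e => decide (p e = 1)) o y) ∨ (¬Conn ends (fun e => decide (p e = 1)) o s ∧ ¬Conn ends (fun e => decide (p e = 1)) o y ∧ Conn ends ω s y)) ∨ (Conn ends (fun e => decide (p e = 1)) o s ∧ (¬Conn ends (fun e => decide (p e = 1)) o y ∧ Conn ends ω y z)) ∨ ((¬Conn ends (fun e => decide (p e = 1)) o s ∧ Conn ends ω s z) ∧ Conn ends (fun e => decide (p e = 1))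 o y))} ∧
      prob (Function.update p f 1) (clusterInEvent ends s {W : Set V | o ∈ W}) =
        prob (Function.update p f 0) {ω : Config E | (Conn ends (fun e => decide (p e = 1)) o s ∨ (¬Conn ends (fun e => decide (p e = 1)) o s ∧ Conn ends ω s z))} ∧
      prob (Function.update p f 1) (clusterInEvent ends s {W : Set V | o ∈ W} ∩ (connEvent ends s y)ᶜ) =
        prob (Function.update p f 0) {ω : Config E | (Conn ends (fun e => decide (p e = 1)) o s ∨ (¬Conn ends (fun e => decide (p e = 1)) o s ∧ Conn ends ω s z)) ∧ ¬(((Conn ends (fun e => decide (p e = 1)) o s ∧ Conn ends (fun e => decide (p e = 1)) o y) ∨ (¬Conn ends (fun e => decide (p e = 1)) o s ∧ ¬Conn ends (fun e => decide (p e = 1)) o y ∧ Conn ends ω s y)) ∨ (Conn ends (fun e => decide (p e = 1)) o s ∧ (¬Conn ends (fun e => decide (p e = 1)) o y ∧ Conn ends ω y z)) ∨ ((¬Conn ends (fun e => decide (p e = 1)) o s ∧ Conn ends ω s z) ∧ Conn ends (fun e => decide (p e = 1)) o y))} ∧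
      prob (Function.update p f 1) (connEvent ends s u) =
        prob (Function.update p f 0) {ω : Config E | (((Conn ends (fun e => decide (p e = 1)) o s ∧ Conn ends (fun e => decide (p e = 1)) o u) ∨ (¬Conn ends (fun e => decide (p e = 1)) o s ∧ ¬Conn ends (fun e => decide (p e = 1)) o u ∧ Conn ends ω s u)) ∨ (Conn ends (fun e => decide (p e = 1)) o s ∧ (¬Conn ends (fun e => decide (p e = 1)) o u ∧ Conn ends ω z u)) ∨ ((¬Conn ends (fun e => decide (p e = 1)) o s ∧ Conn ends ω s z) ∧ Conn ends (fun e => decide (p e = 1)) o u))} ∧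
      prob (Function.update p f 1) (connEvent ends y o ∩ (connEvent ends s y)ᶜ) =
        prob (Function.update p f 0) {ω : Config E | (Conn ends (fun e => decide (p e = 1)) o y ∨ (¬Conn ends (fun e => decide (p e = 1)) o y ∧ Conn ends ω y z)) ∧ ¬(((Conn ends (fun e => decide (p e = 1)) o s ∧ Conn ends (fun e => decide (p e = 1)) o y) ∨ (¬Conn ends (fun e => decide (p e = 1)) o s ∧ ¬Conn ends (fun e => decide (p e = 1)) o y ∧ Conn ends ω s y)) ∨ (Conn ends (fun e => decide (p e = 1)) o s ∧ (¬Conn ends (fun e => decide (p e = 1)) o y ∧ Conn ends ω y z)) ∨ ((¬Conn ends (fun e => decide (p e = 1)) o s ∧ Conn ends ω s z) ∧ Conn ends (fun e => decide (p e = 1)) o y))} := by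
  refine ⟨?_, ?_, ?_, ?_, ?_, ?_, ?_, ?_, ?_⟩ <;>
  · refine prob_update_one_eq_prob_update_zero_of_respects p f fun ω h0 h1 => ?_
    obtain ⟨hsx, hso, hxu, hzo, hxo, hyx, hyo, hxy, hzy, hsu_s, hsy_s, hsz_s, hsu_u, hsy_y, hzu_u, hyz_y⟩ := r21_single_edge_atoms s y u hf hx hz hpf hpin h0 h1
    simp only [Set.mem_inter_iff, mem_connEvent, mem_clusterInEvent, Set.mem_setOf_eq, mem_cluster,
      Set.mem_compl_iff, conn_update_true_iff_or hf]
    by_cases hs : Conn ends (fun e => decide (p e = 1)) o s <;> by_cases hy : Conn ends (fun e => decide (p e = 1)) o y <;> by_cases hu : Conn ends (fun e => decide (p e = 1)) o u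
    all_goals first
      | simp only [Set.mem_inter_iff, mem_connEvent, mem_clusterInEvent, Set.mem_setOf_eq, mem_cluster, Set.mem_compl_iff, hsx, hso, hxu, hzo, hxo, hyx, hyo, hxy, hzy, not_true_eq_false, not_false_eq_true, and_true, and_false, or_false, false_or, true_and, false_and, or_true, true_or, and_assoc, not_or, hs, hy, hu, hsu_s hs, hsy_s hs, hsz_s hs]
      | simp only [Set.mem_inter_iff, mem_connEvent, mem_clusterInEvent, Set.mem_setOf_eq, mem_cluster, Set.mem_compl_iff, hsx, hso, hxu, hzo, hxo, hyx, hyo, hxy, hzy, not_true_eq_false, not_false_eq_true, and_true, and_false, or_false, false_or, true_and, false_and, or_true, true_or, and_assoc, not_or, hs, hy, hu, hsu_u hs hu, hsy_y hs hy, hzu_u hu, hyz_y hy]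
      | simp only [Set.mem_inter_iff, mem_connEvent, mem_clusterInEvent, Set.mem_setOf_eq, mem_cluster, Set.mem_compl_iff, hsx, hso, hxu, hzo, hxo, hyx, hyo, hxy, hzy, not_true_eq_false, not_false_eq_true, and_true, and_false, or_false, false_or, true_and, false_and, or_true, true_or, and_assoc, not_or, hs, hy, hu, hsu_u hs hu, hsy_y hs hy, hzu_u hu]
      | simp only [Set.mem_inter_iff, mem_connEvent, mem_clusterInEvent, Set.mem_setOf_eq, mem_cluster, Set.mem_compl_iff, hsx, hso, hxu, hzo, hxo, hyx, hyo, hxy, hzy, not_true_eq_false, not_false_eq_true, and_true, and_false, or_false, false_or, true_and, false_and, or_true, true_or, and_assoc, not_or, hs, hy, hu, hsu_u hs hu, hyz_y hy]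
      | simp only [Set.mem_inter_iff, mem_connEvent, mem_clusterInEvent, Set.mem_setOf_eq, mem_cluster, Set.mem_compl_iff, hsx, hso, hxu, hzo, hxo, hyx, hyo, hxy, hzy, not_true_eq_false, not_false_eq_true, and_true, and_false, or_false, false_or, true_and, false_and, or_true, true_or, and_assoc, not_or, hs, hy, hu, hsy_y hs hy, hzu_u hu]
      | simp only [Set.mem_inter_iff, mem_connEvent, mem_clusterInEvent, Set.mem_setOf_eq, mem_cluster, Set.mem_compl_iff, hsx, hso, hxu, hzo, hxo, hyx, hyo, hxy, hzy, not_true_eq_false, not_false_eq_true, and_true, and_false, or_false, false_or, true_and, false_and, or_true, true_or, and_assoc, not_or, hs, hy, hu, hsu_u hs hu]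
      | simp only [Set.mem_inter_iff, mem_connEvent, mem_clusterInEvent, Set.mem_setOf_eq, mem_cluster, Set.mem_compl_iff, hsx, hso, hxu, hzo, hxo, hyx, hyo, hxy, hzy, not_true_eq_false, not_false_eq_true, and_true, and_false, or_false, false_or, true_and, false_and, or_true, true_or, and_assoc, not_or, hs, hy, hu, hsy_y hs hy]
      | simp only [Set.mem_inter_iff, mem_connEvent, mem_clusterInEvent, Set.mem_setOf_eq, mem_cluster, Set.mem_compl_iff, hsx, hso, hxu, hzo, hxo, hyx, hyo, hxy, hzy, not_true_eq_false, not_false_eq_true, and_true, and_false, or_false, false_or, true_and, false_and, or_true, true_or, and_assoc, not_or, hs, hy, hu]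

set_option linter.unusedSimpArgs false in
omit [IsStrictOrderedRing R] in
/-- **The closed world of the last edge**: `h = Λ_s`, `ℓ = Λ_y`, and the marks inside `Λ` are constants. -/
lemma r21_single_edge_closed_masses (p : E → R) (ends : E → Sym2 V) (s y o u x z : V) (f : E)
    (hf : ends f = s(x, z)) (hx : Conn ends (fun e => decide (p e = 1)) o x)
    (hz : ¬ Conn ends (fun e => decide (p e = 1)) o z) (hpf : p f ≠ 1)
    (hpin : ∀ e, e ≠ f → (∃ v ∈ ends e, Conn ends (fun e => decide (p e = 1)) o v) →
      p e = 0 ∨ p e = 1) :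
      prob (Function.update p f 0) (connEvent ends s u ∩ clusterInEvent ends s {W : Set V | o ∈ W} ∩ (connEvent ends s y)ᶜ) =
        prob (Function.update p f 0) {ω : Config E | ((Conn ends (fun e => decide (p e = 1)) o s ∧ Conn ends (fun e => decide (p e = 1)) o u) ∨ (¬Conn ends (fun e => decide (p e = 1)) o s ∧ ¬Conn ends (fun e => decide (p e = 1)) o u ∧ Conn ends ω s u)) ∧ Conn ends (fun e => decide (p e = 1)) o s ∧ ¬((Conn ends (fun e => decide (p e = 1)) o s ∧ Conn ends (fun e => decide (p e = 1)) o y) ∨ (¬Conn ends (fun e => decide (p e = 1)) o s ∧ ¬Conn ends (fun e => decide (p e = 1)) o y ∧ Conn ends ω s y))} ∧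
      prob (Function.update p f 0) (connEvent ends s u ∩ connEvent ends y o ∩ (connEvent ends s y)ᶜ) =
        prob (Function.update p f 0) {ω : Config E | ((Conn ends (fun e => decide (p e = 1)) o s ∧ Conn ends (fun e => decide (p e = 1)) o u) ∨ (¬Conn ends (fun e => decide (p e = 1)) o s ∧ ¬Conn ends (fun e => decide (p e = 1)) o u ∧ Conn ends ω s u)) ∧ Conn ends (fun e => decide (p e = 1)) o y ∧ ¬((Conn ends (fun e => decide (p e = 1)) o s ∧ Conn ends (fun e => decide (p e = 1)) o y) ∨ (¬Conn ends (fun e => decide (p e = 1)) o s ∧ ¬Conn ends (fun e => decide (p e = 1)) o y ∧ Conn ends ω s y))} ∧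
      prob (Function.update p f 0) ((connEvent ends s y)ᶜ) =
        prob (Function.update p f 0) {ω : Config E | ¬((Conn ends (fun e => decide (p e = 1)) o s ∧ Conn ends (fun e => decide (p e = 1)) o y) ∨ (¬Conn ends (fun e => decide (p e = 1)) o s ∧ ¬Conn ends (fun e => decide (p e = 1)) o y ∧ Conn ends ω s y))} ∧
      prob (Function.update p f 0) (connEvent ends s u ∩ clusterInEvent ends s {W : Set V | o ∈ W}) =
        prob (Function.update p f 0) {ω : Config E | ((Conn ends (fun e => decide (p e = 1)) o s ∧ Conn ends (fun e => decide (p e = 1)) o u) ∨ (¬Conn ends (fun e => decide (p e = 1)) o s ∧ ¬Conn ends (fun e => decide (p e = 1)) o u ∧ Conn ends ω s u)) ∧ Conn ends (fun e => decide (p e = 1)) o s} ∧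
      prob (Function.update p f 0) (connEvent ends s u ∩ (connEvent ends s y)ᶜ) =
        prob (Function.update p f 0) {ω : Config E | ((Conn ends (fun e => decide (p e = 1)) o s ∧ Conn ends (fun e => decide (p e = 1)) o u) ∨ (¬Conn ends (fun e => decide (p e = 1)) o s ∧ ¬Conn ends (fun e => decide (p e = 1)) o u ∧ Conn ends ω s u)) ∧ ¬((Conn ends (fun e => decide (p e = 1)) o s ∧ Conn ends (fun e => decide (p e = 1)) o y) ∨ (¬Conn ends (fun e => decide (p e = 1)) o s ∧ ¬Conn ends (fun e => decide (p e = 1)) o y ∧ Conn ends ω s y))} ∧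
      prob (Function.update p f 0) (clusterInEvent ends s {W : Set V | o ∈ W}) =
        prob (Function.update p f 0) {_ω : Config E | Conn ends (fun e => decide (p e = 1)) o s} ∧
      prob (Function.update p f 0) (clusterInEvent ends s {W : Set V | o ∈ W} ∩ (connEvent ends s y)ᶜ) =
        prob (Function.update p f 0) {ω : Config E | Conn ends (fun e => decide (p e = 1)) o s ∧ ¬((Conn ends (fun e => decide (p e = 1)) o s ∧ Conn ends (fun e => decide (p e = 1)) o y) ∨ (¬Conn ends (fun e => decide (p e = 1)) o s ∧ ¬Conn ends (fun e => decide (p e = 1)) o y ∧ Conn ends ω s y))} ∧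
      prob (Function.update p f 0) (connEvent ends s u) =
        prob (Function.update p f 0) {ω : Config E | ((Conn ends (fun e => decide (p e = 1)) o s ∧ Conn ends (fun e => decide (p e = 1)) o u) ∨ (¬Conn ends (fun e => decide (p e = 1)) o s ∧ ¬Conn ends (fun e => decide (p e = 1)) o u ∧ Conn ends ω s u))} ∧
      prob (Function.update p f 0) (connEvent ends y o ∩ (connEvent ends s y)ᶜ) =
        prob (Function.update p f 0) {ω : Config E | Conn ends (fun e => decide (p e = 1)) o y ∧ ¬((Conn ends (fun e => decide (p e = 1)) o s ∧ Conn ends (fun e => decide (p e = 1)) o y) ∨ (¬Conn ends (fun e => decide (p e = 1)) o s ∧ ¬Conn ends (fun e => decide (p e = 1)) o y ∧ Conn ends ω s y))} := by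
  refine ⟨?_, ?_, ?_, ?_, ?_, ?_, ?_, ?_, ?_⟩ <;>
  · refine prob_update_zero_congr_of_respects p f fun ω h0 h1 => ?_
    obtain ⟨hsx, hso, hxu, hzo, hxo, hyx, hyo, hxy, hzy, hsu_s, hsy_s, hsz_s, hsu_u, hsy_y, hzu_u, hyz_y⟩ := r21_single_edge_atoms s y u hf hx hz hpf hpin h0 h1
    simp only [Set.mem_inter_iff, mem_connEvent, mem_clusterInEvent, Set.mem_setOf_eq, mem_cluster,
      Set.mem_compl_iff]
    by_cases hs : Conn ends (fun e => decide (p e = 1)) o s <;> by_cases hy : Conn ends (fun e => decide (p e = 1)) o y <;> by_cases hu : Conn ends (fun e => decide (p e = 1)) o u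
    all_goals first
      | simp only [Set.mem_inter_iff, mem_connEvent, mem_clusterInEvent, Set.mem_setOf_eq, mem_cluster, Set.mem_compl_iff, hsx, hso, hxu, hzo, hxo, hyx, hyo, hxy, hzy, not_true_eq_false, not_false_eq_true, and_true, and_false, or_false, false_or, true_and, false_and, or_true, true_or, and_assoc, not_or, hs, hy, hu, hsu_s hs, hsy_s hs, hsz_s hs]
      | simp only [Set.mem_inter_iff, mem_connEvent, mem_clusterInEvent, Set.mem_setOf_eq, mem_cluster, Set.mem_compl_iff, hsx, hso, hxu, hzo, hxo, hyx, hyo, hxy, hzy, not_true_eq_false, not_false_eq_true, and_true, and_false, or_false, false_or, true_and, false_and, or_true, true_or, and_assoc, not_or, hs, hy, hu, hsu_u hs hu, hsy_y hs hy, hzu_u hu, hyz_y hy]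
      | simp only [Set.mem_inter_iff, mem_connEvent, mem_clusterInEvent, Set.mem_setOf_eq, mem_cluster, Set.mem_compl_iff, hsx, hso, hxu, hzo, hxo, hyx, hyo, hxy, hzy, not_true_eq_false, not_false_eq_true, and_true, and_false, or_false, false_or, true_and, false_and, or_true, true_or, and_assoc, not_or, hs, hy, hu, hsu_u hs hu, hsy_y hs hy, hzu_u hu]
      | simp only [Set.mem_inter_iff, mem_connEvent, mem_clusterInEvent, Set.mem_setOf_eq, mem_cluster, Set.mem_compl_iff, hsx, hso, hxu, hzo, hxo, hyx, hyo, hxy, hzy, not_true_eq_false, not_false_eq_true, and_true, and_false, or_false, false_or, true_and, false_and, or_true, true_or, and_assoc, not_or, hs, hy, hu, hsu_u hs hu, hyz_y hy]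
      | simp only [Set.mem_inter_iff, mem_connEvent, mem_clusterInEvent, Set.mem_setOf_eq, mem_cluster, Set.mem_compl_iff, hsx, hso, hxu, hzo, hxo, hyx, hyo, hxy, hzy, not_true_eq_false, not_false_eq_true, and_true, and_false, or_false, false_or, true_and, false_and, or_true, true_or, and_assoc, not_or, hs, hy, hu, hsy_y hs hy, hzu_u hu]
      | simp only [Set.mem_inter_iff, mem_connEvent, mem_clusterInEvent, Set.mem_setOf_eq, mem_cluster, Set.mem_compl_iff, hsx, hso, hxu, hzo, hxo, hyx, hyo, hxy, hzy, not_true_eq_false, not_false_eq_true, and_true, and_false, or_false, false_or, true_and, false_and, or_true, true_or, and_assoc, not_or, hs, hy, hu, hsu_u hs hu]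
      | simp only [Set.mem_inter_iff, mem_connEvent, mem_clusterInEvent, Set.mem_setOf_eq, mem_cluster, Set.mem_compl_iff, hsx, hso, hxu, hzo, hxo, hyx, hyo, hxy, hzy, not_true_eq_false, not_false_eq_true, and_true, and_false, or_false, false_or, true_and, false_and, or_true, true_or, and_assoc, not_or, hs, hy, hu, hsy_y hs hy]
      | simp only [Set.mem_inter_iff, mem_connEvent, mem_clusterInEvent, Set.mem_setOf_eq, mem_cluster, Set.mem_compl_iff, hsx, hso, hxu, hzo, hxo, hyx, hyo, hxy, hzy, not_true_eq_false, not_false_eq_true, and_true, and_false, or_false, false_or, true_and, false_and, or_true, true_or, and_assoc, not_or, hs, hy, hu]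

omit [Fintype E] [DecidableEq E] [IsStrictOrderedRing R] in
/-- The nine events of the re-marked slack as set-builders. -/
lemma r21_remarked_events (ends : E → Sym2 V) (s y z u : V) :
      (connEvent ends s u ∩ clusterInEvent ends s {W : Set V | z ∈ W} ∩ (connEvent ends s y)ᶜ : Set (Config E)) = {ω : Config E | Conn ends ω s u ∧ Conn ends ω s z ∧ ¬Conn ends ω s y} ∧
      (connEvent ends s u ∩ connEvent ends y z ∩ (connEvent ends s y)ᶜ : Set (Config E)) = {ω : Config E | Conn ends ω s u ∧ Conn ends ω y z ∧ ¬Conn ends ω s y} ∧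
      ((connEvent ends s y)ᶜ : Set (Config E)) = {ω : Config E | ¬Conn ends ω s y} ∧
      (connEvent ends s u ∩ clusterInEvent ends s {W : Set V | z ∈ W} : Set (Config E)) = {ω : Config E | Conn ends ω s u ∧ Conn ends ω s z} ∧
      (connEvent ends s u ∩ (connEvent ends s y)ᶜ : Set (Config E)) = {ω : Config E | Conn ends ω s u ∧ ¬Conn ends ω s y} ∧
      (clusterInEvent ends s {W : Set V | z ∈ W} : Set (Config E)) = {ω : Config E | Conn ends ω s z} ∧
      (clusterInEvent ends s {W : Set V | z ∈ W} ∩ (connEvent ends s y)ᶜ : Set (Config E)) = {ω : Config E | Conn ends ω s z ∧ ¬Conn ends ω s y} ∧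
      (connEvent ends s u : Set (Config E)) = {ω : Config E | Conn ends ω s u} ∧
      (connEvent ends y z ∩ (connEvent ends s y)ᶜ : Set (Config E)) = {ω : Config E | Conn ends ω y z ∧ ¬Conn ends ω s y} := by
  refine ⟨?_, ?_, ?_, ?_, ?_, ?_, ?_, ?_, ?_⟩ <;>
  · ext
    simp only [Set.mem_inter_iff, mem_connEvent, mem_clusterInEvent, Set.mem_setOf_eq, mem_cluster,
      Set.mem_compl_iff, and_assoc]

set_option linter.unusedSimpArgs false in
/-- **The last edge of the `o`-exploration has `T_f ≥ 0`** given the closed-world (R2-1) slack with `o`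
re-marked as `z` (needed only when `Λ` carries no mark; otherwise `T_f` is `0`, `0`, or a sum of products
of probabilities). -/
theorem r21_T_nonneg_of_single_edge (p : E → R) (hp : IsProbVec p) (ends : E → Sym2 V) (s y o u x z : V) (f : E)
    (hf : ends f = s(x, z)) (hx : Conn ends (fun e => decide (p e = 1)) o x)
    (hz : ¬ Conn ends (fun e => decide (p e = 1)) o z) (hpf : p f ≠ 1)
    (hpin : ∀ e, e ≠ f → (∃ v ∈ ends e, Conn ends (fun e => decide (p e = 1)) o v) →
      p e = 0 ∨ p e = 1)
    (hR : 0 ≤ (prob (Function.update p f 0) (connEvent ends s u ∩ clusterInEvent ends s {W : Set V | z ∈ W} ∩ (connEvent ends s y)ᶜ) + prob (Function.update p f 0) (connEvent ends s u ∩ connEvent ends y z ∩ (connEvent ends s y)ᶜ) + prob (Function.update p f 0) ((connEvent ends s y)ᶜ) * prob (Function.update p f 0) (connEvent ends s u ∩ clusterInEvent ends s {W : Set V | z ∈ W}) - (prob (Function.update p f 0) (connEvent ends s u ∩ (connEvent ends s y)ᶜ) * prob (Function.update p f 0) (clusterInEvent ends s {W : Set V | z ∈ W}) + prob (Function.update p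 f 0) (clusterInEvent ends s {W : Set V | z ∈ W} ∩ (connEvent ends s y)ᶜ) * prob (Function.update p f 0) (connEvent ends s u) + prob (Function.update p f 0) (connEvent ends y z ∩ (connEvent ends s y)ᶜ) * prob (Function.update p f 0) (connEvent ends s u)))) :
    0 ≤ (prob (Function.update p f 0) (connEvent ends s u ∩ clusterInEvent ends s {W : Set V | o ∈ W} ∩ (connEvent ends s y)ᶜ) + prob (Function.update p f 1) (connEvent ends s u ∩ clusterInEvent ends s {W : Set V | o ∈ W} ∩ (connEvent ends s y)ᶜ) + prob (Function.update p f 0) (connEvent ends s u ∩ connEvent ends y o ∩ (connEvent ends s y)ᶜ) + prob (Function.update p f 1) (connEvent ends s u ∩ connEvent ends y o ∩ (connEvent ends s y)ᶜ) + prob (Function.update p f 0) ((connEvent ends s y)ᶜ) * prob (Function.update p f 1) (connEvent ends s u ∩ clusterInEvent ends s {W : Set V | o ∈ W}) + prob (Function.update p f 1) ((connEvent ends s y)ᶜ) * prob (Function.update p f 0) (connEvent ends s u ∩ clusterInEvent ends s {W : Set V | o ∈ W}) - (prob (Function.update p f 0) (connEvent ends s u ∩ (connEvent ends s y)ᶜ)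 * prob (Function.update p f 1) (clusterInEvent ends s {W : Set V | o ∈ W}) + prob (Function.update p f 1) (connEvent ends s u ∩ (connEvent ends s y)ᶜ) * prob (Function.update p f 0) (clusterInEvent ends s {W : Set V | o ∈ W}) + prob (Function.update p f 0) (clusterInEvent ends s {W : Set V | o ∈ W} ∩ (connEvent ends s y)ᶜ) * prob (Function.update p f 1) (connEvent ends s u) + prob (Function.update p f 1) (clusterInEvent ends s {W : Set V | o ∈ W} ∩ (connEvent ends s y)ᶜ) * prob (Function.update p f 0) (connEvent ends s u) + prob (Function.update p f 0) (connEvent ends y o ∩ (connEvent ends s y)ᶜ) * prob (Function.update p f 1) (connEvent ends s u) + prob (Function.update p f 1) (connEvent ends y o ∩ (connEvent ends s y)ᶜ) * prob (Function.update p f 0) (connEvent ends s u))) := by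
  classical
  obtain ⟨o1, o2, o3, o4, o5, o6, o7, o8, o9⟩ :=
    r21_single_edge_open_masses p ends s y o u x z f hf hx hz hpf hpin
  obtain ⟨c1, c2, c3, c4, c5, c6, c7, c8, c9⟩ :=
    r21_single_edge_closed_masses p ends s y o u x z f hf hx hz hpf hpin
  obtain ⟨z1, z2, z3, z4, z5, z6, z7, z8, z9⟩ := r21_remarked_events (E := E) ends s y z u
  rw [o1, o2, o3, o4, o5, o6, o7, o8, o9, c1, c2, c3, c4, c5, c6, c7, c8, c9]
  rw [z1, z2, z4, z5, z7, z9, z3, z6, z8] at hR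
  have hq : IsProbVec (Function.update p f 0) := hp.update f le_rfl zero_le_one
  have hnn : ∀ A : Set (Config E), 0 ≤ prob (Function.update p f 0) A := fun A => prob_nonneg hq A

  by_cases hs : Conn ends (fun e => decide (p e = 1)) o s <;> by_cases hy : Conn ends (fun e => decide (p e = 1)) o y <;> by_cases hu : Conn ends (fun e => decide (p e = 1)) o u
  all_goals (simp only [hs, hy, hu, not_true_eq_false, not_false_eq_true, and_true, and_false, or_false, false_or,
      true_and, false_and, or_true, true_or, and_assoc, not_or, Set.setOf_false, Set.setOf_true,
      prob_empty, prob_univ, mul_one, mul_zero, one_mul, zero_mul, add_zero, zero_add, sub_zero, or_self, and_self, and_self_left, and_not_self_iff, not_and_self_iff, not_and, and_imp] at hR ⊢)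
  · exact le_rfl
  · exact le_rfl
  · linarith
  · linarith
  · linarith
  · have e1 := prob_inter_add_prob_inter_compl (Function.update p f 0) {ω : Config E | Conn ends ω s u} {ω : Config E | Conn ends ω s z}
    have e2 := prob_compl (Function.update p f 0) {ω : Config E | Conn ends ω s z}
    simp only [← Set.setOf_and, Set.compl_setOf] at e1 e2
    rw [e2]
    linarith [e1]
  · have := mul_nonneg (hnn {ω : Config E | ¬Conn ends ω s y}) (hnn {ω : Config E | Conn ends ω s z})
    linarith [hnn {ω : Config E | Conn ends ω s z ∧ ¬Conn ends ω s y}, hnn {ω : Config E | Conn ends ω s z ∧ Conn ends ω y z ∧ ¬Conn ends ω s y}]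
  · exact hR

end SingleEdge

end Summit.Ventures.PercRepro2
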